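import Summits.HodgeConjecture.HodgeConjecture.Theorems.F0LD1ThetaSliceBricks
import HarnessLib

-- SPLIT NOTE (LD1-p01 g3): this module = §1 + §3 (sorry-free junction theorems) of LD1-plan (g2)'s junction v4 bc7f7ecada6a5bf4; the four
-- brick `def`s (§2) are the statement-only module `Theorems.F0LD1ThetaSliceBricks` (same namespace `…F0LD1ThetaSliceOfBricks`), imported here.

-- statements over the theta-kernel datum elaborate to very large types; elaborate sequentially (as in the ★ kit lineage)
set_option Elab.async false

/-!
# Crux `HLiu418`, line LD1 — organ (Gβ) `ThetaSlice₂` FROM FOUR BRICKS (junction sketch v4, LD1-plan (g2))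

SUB-ORGAN DEFS of (Gβ), each quantified over LITERALLY the binder list of ★ `F0LD1ThetaGermDefs.ThetaSlice₂` (rank 2; PINNED transport
`ιA k = (toAdeleGL g)⁻¹ · k · toAdeleGL g`; the kit pair `hT` and `CompactSpace [U(H)]` are DERIVED in the body, ★ `F0LD2FrameTransportPin` ∕ ★
`compactSpace_adelicGroupData_automorphicQuotient`), in the class currency
`[θ^{μ_W}_Ψ] := MemLp.toLp _ (memLp_toQuotFun_lineThetaLift L 2 H e₁ dV hdV hdV0 ιA hT lam hlam a' hρ μW Ψ (charCM ξ) μ 2)`, pure tensors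
`E(φ ⊗ Φ_f) := piSchwartzBruhatEquiv L⁺ (Fin n') (φ ⊗ₜ Φ_f)`, Hermite functions `h_β := follandHermite (frameV …) β` (the tokens of ★ `F0LD2ThetaTensorCLM`,
★ `F0LD1ThetaClassHermiteSum`, ★ `F0LD1ThetaClassTorusExtraction` §4, ★ `F0LD1ThetaClassFinSliceFinite` §3):
* `HermiteSum` (Gβ-Σ; ★ p850775): every pure-tensor class is the `L²`-sum `Σ_β c_β [θ_{h_β ⊗ Φ_f}]`;
* `TorusProjector` (Gβ-P; ★ p850643 + ★ p850733 §4): for every Hermite index `β` ONE bounded `P_β` preserving closed invariant subspaces, extracting the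
  `β`-component of every pure-tensor class and fixing `[θ_{h_β ⊗ Φ_f}]`;
* `FiniteLevel` (Gβ-L; ★ p850713 + ★ p850702 + ★ p850736): for every finite datum `Φ_f⁰` a level set `S ∋ Φ_f⁰` and a bounded `A` preserving closed invariant
  subspaces, with `A [θ_{φ ⊗ Φ_f}] = [θ_{φ ⊗ Φ_f″}]`, `Φ_f″ ∈ S`, fixing the classes of level `S`, and `span {[θ^{μ_W}_{h_β ⊗ Φ_f}] : Φ_f ∈ S}` finite-dimensional
  for every theta datum `(hρ, μ_W)` and every `β`;
* `MeasureScaling` (Gβ-M; ★ `UnitaryDualPairThetaLiftInvariantMeasure` §0–§1): classes for two finite invariant measures on `[U(W)]` are proportional;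
and the sorry-free JUNCTION `thetaSlice₂_of_bricks : HermiteSum → TorusProjector → FiniteLevel → MeasureScaling → F0LD1ThetaGermDefs.ThetaSlice₂`
(generic half = ★-free linear algebra §1; general generators by the exact pure-tensor reduction ★ `exists_tensor_of_apply_toLp_lineThetaLift_ne_zero`).
HC_CM is proved only modulo the 7 printed citations (2 remaining: hLiu418 = stmt-HodgeConjecture-24832, h413 = stmt-HodgeConjecture-24833) until rung 0 closes; count-neutral.
-/

set_option autoImplicit false
set_option linter.dupNamespace false

noncomputable section

open NumberField NumberField.InfinitePlace MeasureTheory IsDedekindDomain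
open scoped Matrix Kronecker ComplexOrder ENNReal TensorProduct SchwartzMap InnerProductSpace ComplexConjugate Classical
open Literature.NumberTheory.Automorphic Literature.NumberTheory.Automorphic.UnitaryGroup
open Literature.NumberTheory.Automorphic.UnitaryGroup.CotangentForms (toQuotFun)
open Literature.NumberTheory.Automorphic.UnitaryCurveForms
open Literature.NumberTheory.Automorphic.Liu2021 Literature.NumberTheory.Automorphic.Liu2021.Def411WeilCarriers
open Literature.NumberTheory.Automorphic.Liu2021.Def411WeilCarriersDoubling
open Literature.NumberTheory.Automorphic.Liu2021.CinfThetaTorus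
open Literature.NumberTheory.GaloisRepresentations Literature.NumberTheory.Automorphic.IdeleClassGroup
open Literature.NumberTheory.GelbartRogawski1991 Literature.NumberTheory.GelbartRogawski1991.UnitaryDualPair
open Literature.NumberTheory.GelbartRogawski1991.UnitaryDualPair.WeilCoinv
open Literature.NumberTheory.GelbartRogawski1991.GRConstruction
open Literature.NumberTheory.Weil1964
open Literature.RepresentationTheory.Liu2021 Literature.RepresentationTheory.HarrisKudlaSweet1996
open Literature.RepresentationTheory.HeisenbergGroup Literature.Analysis.SegalBargmann
open Literature.RepresentationTheory.KonnoKonno2007 Literature.RepresentationTheory.KonnoKonno2007.RealDualPair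
open Literature.RepresentationTheory.CompactGroups
open Literature.NumberTheory.Rogawski1990
open Summit.HodgeConjecture.HodgeConjecture.Cruxes.HLiu418.F0LD1ThetaTransportKit
open Summit.HodgeConjecture.HodgeConjecture.Cruxes.HLiu418.F0LD2ThetaTensorClasses
open Summit.HodgeConjecture.HodgeConjecture.Cruxes.HLiu418.F0LD2FrameTransportPin
open Summit.HodgeConjecture.HodgeConjecture.Cruxes.HLiu418.F0LD1ThetaGermDefs

namespace Summit.HodgeConjecture.HodgeConjecture.Cruxes.HLiu418.F0LD1ThetaSliceOfBricks

/-! ## §1 Generic linear algebra of the slice (= ★-free half; identical to `F0LD1ThetaSliceGeneric` §3) -/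

section Slice

variable {V : Type*} [NormedAddCommGroup V] [InnerProductSpace ℂ V]

/-- If a linear `E` maps every generator into `F`, then `E (span 𝒞) ≤ F`. [folklore] -/
theorem map_span_le_of_forall_mem (𝒞 : Set V) (E : V →ₗ[ℂ] V) (F : Submodule ℂ V) (hE : ∀ v ∈ 𝒞, E v ∈ F) :
    (Submodule.span ℂ 𝒞).map E ≤ F := by
  rw [Submodule.map_le_iff_le_comap, Submodule.span_le]
  exact fun v hv => hE v hv

/-- **The slice disjunct from bricks** (`E := P ∘ A`). [cite: BorelJacquet1979, §4.6] [cite: BrockerTomDieck1985, III (5.10)] -/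
theorem slice_dichotomy_of_bricks {G : Type*} [Group G] (π : ContRepresentation ℂ G V) (𝒞 : Set V)
    (h : Submodule.span ℂ 𝒞 ≠ ⊥ → ∃ (A P : V →L[ℂ] V) (F : Submodule ℂ V) (w : V),
      (∀ Q : ContRepresentation.ClosedSubrep π, ∀ v ∈ Q, A v ∈ Q) ∧ (∀ Q : ContRepresentation.ClosedSubrep π, ∀ v ∈ Q, P v ∈ Q) ∧
      F ≤ Submodule.span ℂ 𝒞 ∧ FiniteDimensional ℂ F ∧ (∀ c ∈ 𝒞, P (A c) ∈ F) ∧ w ∈ Submodule.span ℂ 𝒞 ∧ P (A w) ≠ 0) :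
    Submodule.span ℂ 𝒞 = ⊥ ∨
      ∃ E : V →L[ℂ] V,
        (∀ Q : ContRepresentation.ClosedSubrep π, ∀ v ∈ Q, E v ∈ Q) ∧
        (∀ v ∈ Submodule.span ℂ 𝒞, E v ∈ Submodule.span ℂ 𝒞) ∧
        FiniteDimensional ℂ ↥((Submodule.span ℂ 𝒞).map E.toLinearMap) ∧
        ∃ w ∈ Submodule.span ℂ 𝒞, E w ≠ 0 := by
  by_cases h0 : Submodule.span ℂ 𝒞 = ⊥
  · exact Or.inl h0
  · obtain ⟨A, P, F, w, hA, hP, hF, hFfin, hE, hw, hw0⟩ := h h0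
    haveI := hFfin
    have hle : (Submodule.span ℂ 𝒞).map (P ∘L A).toLinearMap ≤ F :=
      map_span_le_of_forall_mem 𝒞 (P ∘L A).toLinearMap F (fun c hc => hE c hc)
    exact Or.inr ⟨P ∘L A, fun Q v hv => hP Q _ (hA Q v hv), fun v hv => hF (hle ⟨v, hv, rfl⟩),
      Submodule.finiteDimensional_of_le hle, w, hw, hw0⟩

end Slice

/-! ## §3 The junction: the Hermite slice datum and (Gβ) `ThetaSlice₂` from the four bricks (sorry-free) -/

set_option maxHeartbeats 1600000 in
/-- **THE HERMITE SLICE DATUM FROM THE FOUR BRICKS** (the construction, exposed BY NAME for the (Gα) junction ★ `F0LD1ThetaDichotomyOfBricks`).  Over the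
frames: if the theta span is non-zero there are a level average `A` (Gβ-L), a torus projector `P = P_β` (Gβ-P), ONE theta datum `(hρ, μ_W)`, a torus weight `β`,
a finite level set `S` and `Φ_f ∈ S` such that `A`, `P` preserve closed invariant subspaces, the HERMITE SLICE `F := span {[θ^{μ_W}_{h_β ⊗ Φ_f′}] : Φ_f′ ∈ S}` is a
finite-dimensional subspace of the theta span receiving `P (A c)` for EVERY generator `c` (any datum `(hρ′, μ_W′)`: (Gβ-M) + the exact pure-tensor reduction ★
`exists_tensor_of_apply_toLp_lineThetaLift_ne_zero` applied to `F.mkQ ∘ P ∘ A`), and `w := [θ^{μ_W}_{h_β ⊗ Φ_f}] ≠ 0` with `P (A w) = w` ((Gβ-Σ) picks `β`).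
[cite: BorelJacquet1979, §4.6] [cite: MoeglinVignerasWaldspurger1987, Chap. 3 IV.4] [cite: Rallis1984, §1] -/
theorem exists_hermiteSliceData_of_bricks (hHS : HermiteSum) (hP : TorusProjector) (hL : FiniteLevel) (hM : MeasureScaling) :
  ∀ (L : Type) [Field L] [NumberField L] [IsCMField L] (ι : L →+* ℂ) (H : Matrix (Fin 2) (Fin 2) L)
      (dV : Fin 2 → L) (hdV : ∀ i, IsCMField.complexConj L (dV i) = dV i) (hdV0 : ∀ i, dV i ≠ 0)
      (t : L) (ht : t ≠ 0) (g : GL (Fin 2) L)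
      (hg : formCongr ((IsCMField.complexConj L : L ≃ₐ[↥(maximalRealSubfield L)] L) : L →+* L) g (t • H) = Matrix.diagonal dV),
      (∃ T : GL (Fin 2) ℂ, formCongr (starRingEnd ℂ) T ((Matrix.diagonal dV).map ι) = Matrix.diagonal ![(1 : ℂ), -1]) →
      ∀ (hdef : ∀ τ' : L →+* ℂ, InfinitePlace.mk τ' ≠ InfinitePlace.mk ι → ((Matrix.diagonal dV).map τ').PosDef)
        (hdeg : 4 ≤ Module.finrank ℚ L)
        (μ : Measure (adelicGroupData (↥(maximalRealSubfield L)) L (IsCMField.complexConj L) 2 H).automorphicQuotient)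
        [(adelicGroupData (↥(maximalRealSubfield L)) L (IsCMField.complexConj L) 2 H).IsAutomorphicMeasure μ]
        {n' : ℕ} (e₁ : Fin 2 × Fin 1 ≃ Fin n')
        (lam : Literature.NumberTheory.Automorphic.IdeleClassGroup L →ₜ* Circle) (hlam : IsConjugateSymplectic L lam), HasWeight L lam 1 →
      ∀ (ιA : (adelicGroupData (↥(maximalRealSubfield L)) L (IsCMField.complexConj L) 2 H).Adelic →*
          ↥(UnitaryGroup.adelic (↥(maximalRealSubfield L)) L (IsCMField.complexConj L) 2 (Matrix.diagonal dV)))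
        (hιA : ∀ k, ((ιA k : ↥(UnitaryGroup.adelic (↥(maximalRealSubfield L)) L (IsCMField.complexConj L) 2 (Matrix.diagonal dV))) :
              GL (Fin 2) (AdeleRing (𝓞 L) L)) =
            (toAdeleGL L g)⁻¹ * adelicVal (↥(maximalRealSubfield L)) L (IsCMField.complexConj L) 2 H k * toAdeleGL L g)
        [CompactSpace (↥(UnitaryGroup.adelic (↥(maximalRealSubfield L)) L (IsCMField.complexConj L) 2 (Matrix.diagonal dV)) ⧸
          (UnitaryGroup.toAdelic (↥(maximalRealSubfield L)) L (IsCMField.complexConj L) 2 (Matrix.diagonal dV)).range)]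
        (a' : (↥(maximalRealSubfield L))ˣ)
        (ξ : haveI := normal_range_toAdelic_JW L a'
          PontryaginDual (↥(UnitaryGroup.adelic (↥(maximalRealSubfield L)) L (IsCMField.complexConj L) 1 (JW (↥(maximalRealSubfield L)) L a')) ⧸ (UnitaryGroup.toAdelic (↥(maximalRealSubfield L)) L (IsCMField.complexConj L) 1 (JW (↥(maximalRealSubfield L)) L a')).range)),
        letI : MeasurableSpace (↥(UnitaryGroup.adelic (↥(maximalRealSubfield L)) L (IsCMField.complexConj L) 1 (JW (↥(maximalRealSubfield L)) L a')) ⧸ (UnitaryGroup.toAdelic (↥(maximalRealSubfield L)) L (IsCMField.complexConj L) 1 (JW (↥(maximalRealSubfield L)) L a')).range) := borel _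
        haveI := normal_range_toAdelic_JW L a'
        haveI : CompactSpace (adelicGroupData (↥(maximalRealSubfield L)) L (IsCMField.complexConj L) 2 H).automorphicQuotient :=
          (UnitaryGroup.exists_infinitePlace_ne L hdeg ι).elim fun τ hτ =>
            UnitaryGroup.compactSpace_adelicGroupData_automorphicQuotient L 2 H
              (UnitaryGroup.anisotropic_of_formCongr_smul_eq_of_posDef L 2 H dV t ht g hg τ (hdef τ hτ))
        haveI hT : Continuous ιA ∧ ∀ ⦃γ : (adelicGroupData (↥(maximalRealSubfield L)) L (IsCMField.complexConj L) 2 H).Adelic⦄,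
            γ ∈ (UnitaryGroup.toAdelic (↥(maximalRealSubfield L)) L (IsCMField.complexConj L) 2 H).range →
              ιA γ ∈ (UnitaryGroup.toAdelic (↥(maximalRealSubfield L)) L (IsCMField.complexConj L) 2 (Matrix.diagonal dV)).range :=
          ⟨continuous_of_pin L 2 H dV g ιA hιA, fun _ hγ => mem_range_toAdelic_of_pin L 2 H dV t ht g hg ιA hιA hγ⟩
        Submodule.span ℂ (lineThetaClassSet L 2 H e₁ dV hdV hdV0 ιA μ lam hlam a' ξ) ≠ ⊥ →
          ∃ (A P : ((adelicGroupData (↥(maximalRealSubfield L)) L (IsCMField.complexConj L) 2 H).L2 μ) →L[ℂ] ((adelicGroupData (↥(maximalRealSubfield L)) L (IsCMField.complexConj L) 2 H).L2 μ))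
            (hρ : HasThetaMajorants fun
              (p : ↥(UnitaryGroup.adelic (↥(maximalRealSubfield L)) L (IsCMField.complexConj L) 2 (Matrix.diagonal dV)) × ↥(UnitaryGroup.adelic (↥(maximalRealSubfield L)) L (IsCMField.complexConj L) 1 (JW (↥(maximalRealSubfield L)) L a'))) (Φ : piSchwartzBruhat (↥(maximalRealSubfield L)) (Fin n')) =>
                pairRep (↥(maximalRealSubfield L)) L (IsCMField.complexConj L) 2 1 e₁ (Matrix.diagonal dV) (JW (↥(maximalRealSubfield L)) L a')
                  (chiSplittingLine L e₁ dV hdV hdV0 (toHeckeCharacter L lam) (isUnitary_toHeckeCharacter L lam)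
                    ((isOscillatorChar_toHeckeCharacter_iff lam).mpr hlam) (TW (↥(maximalRealSubfield L)) a')
                    (isUnit_det_TW (↥(maximalRealSubfield L)) a') (JW (↥(maximalRealSubfield L)) L a') (JW_eq (↥(maximalRealSubfield L)) L a'))
                  p Φ)
            (μW : Measure (↥(UnitaryGroup.adelic (↥(maximalRealSubfield L)) L (IsCMField.complexConj L) 1 (JW (↥(maximalRealSubfield L)) L a')) ⧸ (UnitaryGroup.toAdelic (↥(maximalRealSubfield L)) L (IsCMField.complexConj L) 1 (JW (↥(maximalRealSubfield L)) L a')).range)) (_ : IsFiniteMeasure μW) (_ : SMulInvariantMeasure ↥(UnitaryGroup.adelic (↥(maximalRealSubfield L)) L (IsCMField.complexConj L) 1 (JW (↥(maximalRealSubfield L)) L a')) (↥(UnitaryGroup.adelic (↥(maximalRealSubfield L)) L (IsCMField.complexConj L) 1 (JW (↥(maximalRealSubfield L)) L a')) ⧸ (UnitaryGroup.toAdelic (↥(maximalRealSubfield L)) L (IsCMField.complexConj L) 1 (JW (↥(maximalRealSubfield L)) L a')).range) μW)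
            (β : ((Fin n' × {v : InfinitePlace (↥(maximalRealSubfield L)) // v.IsReal}) →₀ ℕ)) (S : Set (FinSB (↥(maximalRealSubfield L)) (Fin n'))) (Φf : FinSB (↥(maximalRealSubfield L)) (Fin n')),
            (∀ Q : ContRepresentation.ClosedSubrep ((adelicGroupData (↥(maximalRealSubfield L)) L (IsCMField.complexConj L) 2 H).rightRegular μ), ∀ v ∈ Q, A v ∈ Q) ∧
            (∀ Q : ContRepresentation.ClosedSubrep ((adelicGroupData (↥(maximalRealSubfield L)) L (IsCMField.complexConj L) 2 H).rightRegular μ), ∀ v ∈ Q, P v ∈ Q) ∧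
            Submodule.span ℂ {v : ((adelicGroupData (↥(maximalRealSubfield L)) L (IsCMField.complexConj L) 2 H).L2 μ) | ∃ Φf' : FinSB (↥(maximalRealSubfield L)) (Fin n'), Φf' ∈ S ∧
              v = MemLp.toLp _ (memLp_toQuotFun_lineThetaLift L 2 H e₁ dV hdV hdV0 ιA hT lam hlam a' hρ μW
            (piSchwartzBruhatEquiv (↥(maximalRealSubfield L)) (Fin n') (follandHermite (frameV L e₁ dV hdV hdV0 (lineW L (TW (Fp L) a')) (complexConj_lineW L (TW (Fp L) a'))
                (lineW_ne_zero L (TW (Fp L) a') (isUnit_det_TW (Fp L) a'))) β ⊗ₜ[ℂ] Φf')) (charCM ξ) μ 2)} ≤ Submodule.span ℂ (lineThetaClassSet L 2 H e₁ dV hdV hdV0 ιA μ lam hlam a' ξ) ∧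
            FiniteDimensional ℂ ↥(Submodule.span ℂ {v : ((adelicGroupData (↥(maximalRealSubfield L)) L (IsCMField.complexConj L) 2 H).L2 μ) | ∃ Φf' : FinSB (↥(maximalRealSubfield L)) (Fin n'), Φf' ∈ S ∧
              v = MemLp.toLp _ (memLp_toQuotFun_lineThetaLift L 2 H e₁ dV hdV hdV0 ιA hT lam hlam a' hρ μW
            (piSchwartzBruhatEquiv (↥(maximalRealSubfield L)) (Fin n') (follandHermite (frameV L e₁ dV hdV hdV0 (lineW L (TW (Fp L) a')) (complexConj_lineW L (TW (Fp L) a'))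
                (lineW_ne_zero L (TW (Fp L) a') (isUnit_det_TW (Fp L) a'))) β ⊗ₜ[ℂ] Φf')) (charCM ξ) μ 2)}) ∧
            (∀ c ∈ lineThetaClassSet L 2 H e₁ dV hdV hdV0 ιA μ lam hlam a' ξ, P (A c) ∈ Submodule.span ℂ {v : ((adelicGroupData (↥(maximalRealSubfield L)) L (IsCMField.complexConj L) 2 H).L2 μ) | ∃ Φf' : FinSB (↥(maximalRealSubfield L)) (Fin n'), Φf' ∈ S ∧
              v = MemLp.toLp _ (memLp_toQuotFun_lineThetaLift L 2 H e₁ dV hdV hdV0 ιA hT lam hlam a' hρ μW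
            (piSchwartzBruhatEquiv (↥(maximalRealSubfield L)) (Fin n') (follandHermite (frameV L e₁ dV hdV hdV0 (lineW L (TW (Fp L) a')) (complexConj_lineW L (TW (Fp L) a'))
                (lineW_ne_zero L (TW (Fp L) a') (isUnit_det_TW (Fp L) a'))) β ⊗ₜ[ℂ] Φf')) (charCM ξ) μ 2)}) ∧
            Φf ∈ S ∧
            P (A (MemLp.toLp _ (memLp_toQuotFun_lineThetaLift L 2 H e₁ dV hdV hdV0 ιA hT lam hlam a' hρ μW
            (piSchwartzBruhatEquiv (↥(maximalRealSubfield L)) (Fin n') (follandHermite (frameV L e₁ dV hdV hdV0 (lineW L (TW (Fp L) a')) (complexConj_lineW L (TW (Fp L) a'))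
                (lineW_ne_zero L (TW (Fp L) a') (isUnit_det_TW (Fp L) a'))) β ⊗ₜ[ℂ] Φf)) (charCM ξ) μ 2))) =
              MemLp.toLp _ (memLp_toQuotFun_lineThetaLift L 2 H e₁ dV hdV hdV0 ιA hT lam hlam a' hρ μW
            (piSchwartzBruhatEquiv (↥(maximalRealSubfield L)) (Fin n') (follandHermite (frameV L e₁ dV hdV hdV0 (lineW L (TW (Fp L) a')) (complexConj_lineW L (TW (Fp L) a'))
                (lineW_ne_zero L (TW (Fp L) a') (isUnit_det_TW (Fp L) a'))) β ⊗ₜ[ℂ] Φf)) (charCM ξ) μ 2) ∧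
            MemLp.toLp _ (memLp_toQuotFun_lineThetaLift L 2 H e₁ dV hdV hdV0 ιA hT lam hlam a' hρ μW
            (piSchwartzBruhatEquiv (↥(maximalRealSubfield L)) (Fin n') (follandHermite (frameV L e₁ dV hdV hdV0 (lineW L (TW (Fp L) a')) (complexConj_lineW L (TW (Fp L) a'))
                (lineW_ne_zero L (TW (Fp L) a') (isUnit_det_TW (Fp L) a'))) β ⊗ₜ[ℂ] Φf)) (charCM ξ) μ 2) ≠ 0 := by
  intro L _ _ _ ι H dV hdV hdV0 t ht g hg hsig hdef hdeg μ _ n' e₁ lam hlam hw ιA hιA _ a' ξ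
  letI : MeasurableSpace (↥(UnitaryGroup.adelic (↥(maximalRealSubfield L)) L (IsCMField.complexConj L) 1 (JW (↥(maximalRealSubfield L)) L a')) ⧸ (UnitaryGroup.toAdelic (↥(maximalRealSubfield L)) L (IsCMField.complexConj L) 1 (JW (↥(maximalRealSubfield L)) L a')).range) := borel _
  haveI : BorelSpace (↥(UnitaryGroup.adelic (↥(maximalRealSubfield L)) L (IsCMField.complexConj L) 1 (JW (↥(maximalRealSubfield L)) L a')) ⧸ (UnitaryGroup.toAdelic (↥(maximalRealSubfield L)) L (IsCMField.complexConj L) 1 (JW (↥(maximalRealSubfield L)) L a')).range) := ⟨rfl⟩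
  haveI hN := normal_range_toAdelic_JW L a'
  -- (0) `[U(H)]` is compact (a definite place exists since `[L : ℚ] ≥ 4`)
  haveI : CompactSpace (adelicGroupData (↥(maximalRealSubfield L)) L (IsCMField.complexConj L) 2 H).automorphicQuotient := by
    obtain ⟨τ, hτ⟩ := UnitaryGroup.exists_infinitePlace_ne L hdeg ι
    exact UnitaryGroup.compactSpace_adelicGroupData_automorphicQuotient L 2 H
      (UnitaryGroup.anisotropic_of_formCongr_smul_eq_of_posDef L 2 H dV t ht g hg τ (hdef τ hτ))
  -- (1) the pinned transport is continuous and carries rational points to rational points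
  have hT : Continuous ιA ∧ ∀ ⦃γ : (adelicGroupData (↥(maximalRealSubfield L)) L (IsCMField.complexConj L) 2 H).Adelic⦄,
      γ ∈ (UnitaryGroup.toAdelic (↥(maximalRealSubfield L)) L (IsCMField.complexConj L) 2 H).range →
        ιA γ ∈ (UnitaryGroup.toAdelic (↥(maximalRealSubfield L)) L (IsCMField.complexConj L) 2 (Matrix.diagonal dV)).range :=
    ⟨continuous_of_pin L 2 H dV g ιA hιA, fun γ hγ => mem_range_toAdelic_of_pin L 2 H dV t ht g hg ιA hιA hγ⟩
  intro hne
  -- (2a) a non-zero generator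
  obtain ⟨c, hc𝒞, hc0⟩ : ∃ c ∈ lineThetaClassSet L 2 H e₁ dV hdV hdV0 ιA μ lam hlam a' ξ, c ≠ 0 := by
    by_contra h'
    push Not at h'
    exact hne (Submodule.span_eq_bot.2 h')
  obtain ⟨hρ, μW, hfin, hinv, Ψ, hθ, rfl⟩ := hc𝒞
  haveI := hfin
  haveI := hinv
  -- (2b) a non-zero PURE-TENSOR class (★ exact span of pure tensors, no continuity)
  have hc0' : LinearMap.id (R := ℂ) (MemLp.toLp _ (memLp_toQuotFun_lineThetaLift L 2 H e₁ dV hdV hdV0 ιA hT lam hlam a' hρ μW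
            (Ψ) (charCM ξ) μ 2)) ≠ 0 := hc0
  obtain ⟨Φinf, Φfin, hΦfin, hne'⟩ :=
    exists_tensor_of_apply_toLp_lineThetaLift_ne_zero L 2 H e₁ dV hdV hdV0 ιA hT lam hlam a' hρ μW (charCM ξ) μ LinearMap.id Ψ hc0'
  rw [LinearMap.id_apply] at hne'
  have hraw : (⟨fun v => Φinf (piArch (↥(maximalRealSubfield L)) (Fin n') v) * Φfin (piFinite (↥(maximalRealSubfield L)) (Fin n') v),
      tensor_mem_piSchwartzBruhat Φinf hΦfin⟩ : piSchwartzBruhat (↥(maximalRealSubfield L)) (Fin n')) =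
      piSchwartzBruhatEquiv (↥(maximalRealSubfield L)) (Fin n') (Φinf ⊗ₜ[ℂ] (⟨Φfin, hΦfin⟩ : FinSB (↥(maximalRealSubfield L)) (Fin n'))) :=
    Subtype.ext (coe_piSchwartzBruhatEquiv_tmul (↥(maximalRealSubfield L)) (Fin n') Φinf ⟨Φfin, hΦfin⟩).symm
  rw [toLp_lineThetaLift_congr L 2 H e₁ dV hdV hdV0 ιA hT lam hlam a' hρ μW (charCM ξ) μ hraw] at hne'
  set Φf : FinSB (↥(maximalRealSubfield L)) (Fin n') := ⟨Φfin, hΦfin⟩ with hΦf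
  -- (2c) a non-zero HERMITE pure-tensor class `w = [θ_{h_β ⊗ Φ_f}]` (Gβ-Σ)
  obtain ⟨cβ, hsum⟩ := hHS L ι H dV hdV hdV0 t ht g hg hsig hdef hdeg μ e₁ lam hlam hw ιA hιA a' ξ hρ μW Φinf Φf
  obtain ⟨β, hβ⟩ : ∃ β, cβ β • MemLp.toLp _ (memLp_toQuotFun_lineThetaLift L 2 H e₁ dV hdV hdV0 ιA hT lam hlam a' hρ μW
            (piSchwartzBruhatEquiv (↥(maximalRealSubfield L)) (Fin n') (follandHermite (frameV L e₁ dV hdV hdV0 (lineW L (TW (Fp L) a')) (complexConj_lineW L (TW (Fp L) a'))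
                (lineW_ne_zero L (TW (Fp L) a') (isUnit_det_TW (Fp L) a'))) β ⊗ₜ[ℂ] Φf)) (charCM ξ) μ 2) ≠ 0 := by
    by_contra h'
    push Not at h'
    exact hne' (hsum.unique (by rw [show (fun β => cβ β • _) = fun _ => (0 : ((adelicGroupData (↥(maximalRealSubfield L)) L (IsCMField.complexConj L) 2 H).L2 μ)) from funext h']; exact hasSum_zero))
  have hw0' : MemLp.toLp _ (memLp_toQuotFun_lineThetaLift L 2 H e₁ dV hdV hdV0 ιA hT lam hlam a' hρ μW
            (piSchwartzBruhatEquiv (↥(maximalRealSubfield L)) (Fin n') (follandHermite (frameV L e₁ dV hdV hdV0 (lineW L (TW (Fp L) a')) (complexConj_lineW L (TW (Fp L) a'))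
                (lineW_ne_zero L (TW (Fp L) a') (isUnit_det_TW (Fp L) a'))) β ⊗ₜ[ℂ] Φf)) (charCM ξ) μ 2) ≠ 0 := by
    intro h0
    exact hβ (by rw [h0, smul_zero])
  -- (2d) the level of `Φ_f` (Gβ-L) and the projector of type `β` (Gβ-P)
  obtain ⟨S, A, hS0, hAQ, hAavg, hAfix, hFin⟩ := hL L ι H dV hdV hdV0 t ht g hg hsig hdef hdeg μ e₁ lam hlam hw ιA hιA a' ξ Φf
  obtain ⟨P, hPQ, hPext, hPfix⟩ := hP L ι H dV hdV hdV0 t ht g hg hsig hdef hdeg μ e₁ lam hlam hw ιA hιA a' ξ β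
  haveI hFβ := hFin hρ μW β
  refine ⟨A, P, hρ, μW, hfin, hinv, β, S, Φf, hAQ, hPQ, ?_, hFβ, ?_, hS0, ?_, hw0'⟩
  · -- `F ≤ span 𝒞`: its generators are theta classes (datum `(hρ, μ_W)`)
    refine Submodule.span_le.2 ?_
    rintro v ⟨Φf', -, rfl⟩
    refine Submodule.subset_span ⟨hρ, μW, hfin, hinv, _,
      memLp_toQuotFun_lineThetaLift L 2 H e₁ dV hdV hdV0 ιA hT lam hlam a' hρ μW
        (piSchwartzBruhatEquiv (↥(maximalRealSubfield L)) (Fin n') (follandHermite (frameV L e₁ dV hdV hdV0 (lineW L (TW (Fp L) a')) (complexConj_lineW L (TW (Fp L) a'))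
                (lineW_ne_zero L (TW (Fp L) a') (isUnit_det_TW (Fp L) a'))) β ⊗ₜ[ℂ] Φf')) (charCM ξ) μ 2, ?_⟩
    rfl
  · -- `P (A c′) ∈ F` for every generator `c′ = [θ^{μ_W′}_{Ψ′}]`
    rintro c' ⟨hρ', μW', hfin', hinv', Ψ', hθ', rfl⟩
    haveI := hfin'
    haveI := hinv'
    have hcls : MemLp.toLp _ hθ' = MemLp.toLp _ (memLp_toQuotFun_lineThetaLift L 2 H e₁ dV hdV hdV0 ιA hT lam hlam a' hρ' μW'
            (Ψ') (charCM ξ) μ 2) := rfl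
    rw [hcls]
    -- one scalar moving `μ_W′`-classes to `μ_W`-classes (Gβ-M)
    obtain ⟨c₁, hc₁⟩ := hM L ι H dV hdV hdV0 t ht g hg hsig hdef hdeg μ e₁ lam hlam hw ιA hιA a' ξ hρ hρ' μW μW' ⟨_, hw0'⟩
    -- the pure-tensor generators
    have hpure : ∀ (φ : 𝓢((Fin n' → mixedEmbedding.mixedSpace ↥(maximalRealSubfield L)), ℂ)) (Φf' : FinSB (↥(maximalRealSubfield L)) (Fin n')),
        P (A (MemLp.toLp _ (memLp_toQuotFun_lineThetaLift L 2 H e₁ dV hdV hdV0 ιA hT lam hlam a' hρ' μW'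
            (piSchwartzBruhatEquiv (↥(maximalRealSubfield L)) (Fin n') (φ ⊗ₜ[ℂ] Φf')) (charCM ξ) μ 2))) ∈
          Submodule.span ℂ {v : ((adelicGroupData (↥(maximalRealSubfield L)) L (IsCMField.complexConj L) 2 H).L2 μ) | ∃ Φf : FinSB (↥(maximalRealSubfield L)) (Fin n'), Φf ∈ S ∧
              v = MemLp.toLp _ (memLp_toQuotFun_lineThetaLift L 2 H e₁ dV hdV hdV0 ιA hT lam hlam a' hρ μW
            (piSchwartzBruhatEquiv (↥(maximalRealSubfield L)) (Fin n') (follandHermite (frameV L e₁ dV hdV hdV0 (lineW L (TW (Fp L) a')) (complexConj_lineW L (TW (Fp L) a'))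
                (lineW_ne_zero L (TW (Fp L) a') (isUnit_det_TW (Fp L) a'))) β ⊗ₜ[ℂ] Φf)) (charCM ξ) μ 2)} := by
      intro φ Φf'
      obtain ⟨Φf'', hS'', hA⟩ := hAavg hρ' μW' φ Φf'
      rw [hA]
      obtain ⟨c₂, hc₂⟩ := hPext hρ' μW' φ Φf''
      rw [hc₂, hc₁]
      exact Submodule.smul_mem _ c₂ (Submodule.smul_mem _ c₁ (Submodule.subset_span ⟨Φf'', hS'', rfl⟩))
    -- every generator, by the exact pure-tensor reduction applied to `F.mkQ ∘ P ∘ A` (★, no continuity)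
    by_contra hnot
    have hT0 : ((Submodule.span ℂ {v : ((adelicGroupData (↥(maximalRealSubfield L)) L (IsCMField.complexConj L) 2 H).L2 μ) | ∃ Φf : FinSB (↥(maximalRealSubfield L)) (Fin n'), Φf ∈ S ∧
              v = MemLp.toLp _ (memLp_toQuotFun_lineThetaLift L 2 H e₁ dV hdV hdV0 ιA hT lam hlam a' hρ μW
            (piSchwartzBruhatEquiv (↥(maximalRealSubfield L)) (Fin n') (follandHermite (frameV L e₁ dV hdV hdV0 (lineW L (TW (Fp L) a')) (complexConj_lineW L (TW (Fp L) a'))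
                (lineW_ne_zero L (TW (Fp L) a') (isUnit_det_TW (Fp L) a'))) β ⊗ₜ[ℂ] Φf)) (charCM ξ) μ 2)}).mkQ ∘ₗ
            ((P : ((adelicGroupData (↥(maximalRealSubfield L)) L (IsCMField.complexConj L) 2 H).L2 μ) →ₗ[ℂ] ((adelicGroupData (↥(maximalRealSubfield L)) L (IsCMField.complexConj L) 2 H).L2 μ)) ∘ₗ (A : ((adelicGroupData (↥(maximalRealSubfield L)) L (IsCMField.complexConj L) 2 H).L2 μ) →ₗ[ℂ] ((adelicGroupData (↥(maximalRealSubfield L)) L (IsCMField.complexConj L) 2 H).L2 μ))))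
          (MemLp.toLp _ (memLp_toQuotFun_lineThetaLift L 2 H e₁ dV hdV hdV0 ιA hT lam hlam a' hρ' μW'
            (Ψ') (charCM ξ) μ 2)) ≠ 0 := by
      intro h0
      apply hnot
      simpa only [LinearMap.comp_apply, Submodule.mkQ_apply, ContinuousLinearMap.coe_coe, Submodule.Quotient.mk_eq_zero] using h0
    obtain ⟨Φinf', Φfin', hΦfin', hne''⟩ :=
      exists_tensor_of_apply_toLp_lineThetaLift_ne_zero L 2 H e₁ dV hdV hdV0 ιA hT lam hlam a' hρ' μW' (charCM ξ) μ _ Ψ' hT0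
    apply hne''
    have hraw' : (⟨fun v => Φinf' (piArch (↥(maximalRealSubfield L)) (Fin n') v) * Φfin' (piFinite (↥(maximalRealSubfield L)) (Fin n') v),
        tensor_mem_piSchwartzBruhat Φinf' hΦfin'⟩ : piSchwartzBruhat (↥(maximalRealSubfield L)) (Fin n')) =
        piSchwartzBruhatEquiv (↥(maximalRealSubfield L)) (Fin n') (Φinf' ⊗ₜ[ℂ] (⟨Φfin', hΦfin'⟩ : FinSB (↥(maximalRealSubfield L)) (Fin n'))) :=
      Subtype.ext (coe_piSchwartzBruhatEquiv_tmul (↥(maximalRealSubfield L)) (Fin n') Φinf' ⟨Φfin', hΦfin'⟩).symm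
    rw [toLp_lineThetaLift_congr L 2 H e₁ dV hdV hdV0 ιA hT lam hlam a' hρ' μW' (charCM ξ) μ hraw']
    simp only [LinearMap.comp_apply, Submodule.mkQ_apply, ContinuousLinearMap.coe_coe, Submodule.Quotient.mk_eq_zero]
    exact hpure Φinf' ⟨Φfin', hΦfin'⟩
  · -- `P (A w) = w`
    rw [hAfix hρ μW _ Φf hS0, hPfix hρ μW Φf]

/-- **ORGAN (Gβ) FROM ITS FOUR BRICKS** — `ThetaSlice₂` with `E := P_β ∘ A` from `exists_hermiteSliceData_of_bricks` (§1 generic half).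
[cite: BorelJacquet1979, §4.6] [cite: MoeglinVignerasWaldspurger1987, Chap. 3 IV.4] -/
theorem thetaSlice₂_of_bricks (hHS : HermiteSum) (hP : TorusProjector) (hL : FiniteLevel) (hM : MeasureScaling) : ThetaSlice₂ := by
  intro L _ _ _ ι H dV hdV hdV0 t ht g hg hsig hdef hdeg μ _ n' e₁ lam hlam hw ιA hιA _ a' ξ
  refine slice_dichotomy_of_bricks _ _ fun hne => ?_
  obtain ⟨A, P, hρ, μW, hfin, hinv, β, S, Φf, hAQ, hPQ, hle, hFβ, hgen, -, hfix, hw0⟩ :=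
    exists_hermiteSliceData_of_bricks hHS hP hL hM L ι H dV hdV hdV0 t ht g hg hsig hdef hdeg μ e₁ lam hlam hw ιA hιA a' ξ hne
  haveI := hfin
  haveI := hinv
  exact ⟨A, P, _, _, hAQ, hPQ, hle, hFβ, hgen, Submodule.subset_span ⟨hρ, μW, hfin, hinv, _, _, rfl⟩, by rw [hfix]; exact hw0⟩

end Summit.HodgeConjecture.HodgeConjecture.Cruxes.HLiu418.F0LD1ThetaSliceOfBricks

end
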